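import Summits.AtomisticToContinuum.BoseEinsteinCondensation.Theses.BECInsertionCorrector
import Summits.AtomisticToContinuum.BoseEinsteinCondensation.Theses.BECPeriodicReduction
import Summits.AtomisticToContinuum.BoseEinsteinCondensation.Theorems.BECInsertionCorrectorBoundaryTransferWeakMultiplicativeTransfer
import Summits.AtomisticToContinuum.BoseEinsteinCondensation.Theorems.BECInsertionCorrectorBoundaryTransferWeakClosing
import Summits.AtomisticToContinuum.BoseEinsteinCondensation.Theorems.BECInsertionCorrectorBoundaryTransferWeakTorusTypicalityBath
import Summits.AtomisticToContinuum.BoseEinsteinCondensation.Theorems.BECInsertionCorrectorBoundaryTransferWeakBoxTransferBath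

/-!
# Crux `BoundaryTransferWeak` (stmt-AtomisticToContinuum-0827), line `Sketch` (idea
# `coupled-bath-relocation`): the REDUCTION of the crux to the coupled relocation bound

`boundaryTransferWeak_of_coupledRelocationBound : CoupledRelocationBound → GroundStateRigidity →
BoundaryTransferWeak` — the line's skeleton (`Cruxes/BoundaryTransferWeak/Lines/Sketch.lean`, v2)
with its four landed stubs plugged in, so that the per-potential transfer
"periodic ground-state BEC ⇒ dilute Dirichlet ground-state BEC" (`BECPeriodicReduction.BoundaryTransferWeak`,
`rfl`-equal to `BECInsertionCorrector.BoundaryTransferWeak` and the 75 other route copies) is CLOSED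
MODULO exactly two named statements:

* the line's research stub `CoupledRelocationBound` (v2, bath level; written out in full as the
  first hypothesis, in the vocabulary of `Literature.MathematicalPhysics.QuantumManyBody.BoseGas` and
  the tree's `groundState`): for every admissible `v`, at small density, for all `ε, η > 0` there is
  `M` such that eventually in `N = n+1` (whenever `E₀^D < ⊤`), at some slack `δ > 0`, for every torus
  `δ`-near-minimiser `Φ`, the Dirichlet ground-state law `(groundState v (n+1) L)² dZ` and the torus
  law `|Φ|² 1_{cell^{n+1}} dW` admit a coupling charging with probability `≥ 1 - η` a measurable set
  of pairs whose one-body SLICES `ψ = Ψ_D(·, tail Z)`, `φ = |Φ(·, tail W)|` have bounded relative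
  relocation cost on the inner cube `C = (L/4, 3L/4)³` off a small exceptional set (`ψ(x)φ(y) ≤
  e^M ψ(y)φ(x)` on `(C ∖ S)²`) and a one-directional bound from `C` outwards (`ψ(y)φ(x) ≤
  e^M ψ(x)φ(y)`, `x ∈ C ∖ S`, `y ∈ (cell ∖ C) ∖ T`, `T` of small `ψ`-mass) — no printed source;
* the pooled item `BECWallDressingTransfer.GroundStateRigidity` (stmt-AtomisticToContinuum-9072):
  `L²`-rigidity of Dirichlet near-minimisers up to phase.

Ingredients (all landed, `--supports stmt-AtomisticToContinuum-0827`): `stub_torusTypicalityBath`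
(p141327; where the hypothesis `A(v)` enters: sub-cube pigeonhole, rigid translation, one-bath
disintegration, reverse Markov), `stub_multiplicativeTransfer` (p139456; Bhattacharyya flatness
transfers multiplicatively), `stub_boxTransferBath` (p143900; the coupling arithmetic on the box
side), `stub_closing` (p140758; ground state → near-minimisers → rigidity → `condensateNumber`), and
`BECInsertionVariance.eventually_groundStateEnergy_ne_top` (finite Dirichlet energies eventually at
low density).  The assembly below is quantifier bookkeeping: thresholds
`min (min ρ_A ρ₁) (min ρ_e ρ₂)`, tolerances `ε = min (√c/8) (1/2)`, `η = c/32`, the shift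
`N = n + 1` along `tendsto_add_atTop_nat 1`, torus slack `min δ_A δ_R`.

The v1 typing of the research stub (idea card; also line `coupled_baths_certified`) demanded in
addition that the tagged particles agree on `C`-membership inside the probability-`(1-η)` event; that
is impossible already at `v = 0` (`Q{z₀ ∈ C} = (1/2 + 1/π)³ = 0.548` for the sine-product ground state
vs `P{w₀ ∈ C} = 1/8` for the constant torus state), which is why v2 works at BATH level
(`Cruxes/BoundaryTransferWeak/Lines/Sketch.md`).
-/

noncomputable section

namespace Summit.AtomisticToContinuum.BoseEinsteinCondensation.CoupledBaths

open Literature.MathematicalPhysics.QuantumManyBody.BoseGas MeasureTheory Filter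
open scoped ENNReal NNReal ComplexConjugate
open ENNReal (ofReal)
open Matrix (vecCons vecTail)
open Summit.AtomisticToContinuum.BoseEinsteinCondensation.Theses

/-- The box constant of the line is positive for the assembly's tolerances (`ε ≤ √c/8`, `ε ≤ 1/2`,
`η < c/16`). [folklore] -/
private theorem boxConstant_pos {c ε η : ℝ} (M : ℝ) (hc : 0 < c) (hε1 : ε ≤ Real.sqrt c / 8)
    (hε2 : ε ≤ 1 / 2) (hη : η < c / 16) :
    0 < (c / 16 - η) * ((Real.exp (-2 * M) * ((1 - ε) * (Real.sqrt c / 4 - ε) ^ 2)) *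
          ((1 - ε) / (1 + 16 * Real.exp (2 * M) / (c * (1 - ε))))) / 2 := by
  have h1 : 0 < c / 16 - η := by linarith
  have h2 : 0 < 1 - ε := by linarith
  have hsc : 0 < Real.sqrt c := Real.sqrt_pos.2 hc
  have h3 : 0 < Real.sqrt c / 4 - ε := by linarith
  positivity

/-- **Reduction of the crux to the coupled relocation bound** (registered as
`boundaryTransferWeak_of_coupledRelocationBound` on stmt-AtomisticToContinuum-0827): the line's research
stub `CoupledRelocationBound` (v2, bath level, first hypothesis, written out) and the pooled
`GroundStateRigidity` (stmt-9072) imply the per-potential boundary-condition transfer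
`BECPeriodicReduction.BoundaryTransferWeak`.  Proof: the assembly of line `Sketch` over its landed
stubs. [folklore] -/
theorem boundaryTransferWeak_of_coupledRelocationBound :
    (∀ v : ℝ → ℝ≥0∞, IsRepulsiveFiniteRange v → ∃ ρ₁ : ℝ, 0 < ρ₁ ∧ ∀ ρ : ℝ, 0 < ρ → ρ < ρ₁ → ∀ ε :
      ℝ, 0 < ε → ∀ η : ℝ, 0 < η → ∃ M : ℝ, ∀ᶠ n : ℕ in atTop, groundStateEnergy v (n + 1)
      (sideLength ρ (n + 1)) ≠ ⊤ → ∃ δ : ℝ≥0∞, 0 < δ ∧ ∀ Φ : PeriodicTrialState (n + 1) (sideLength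
      ρ (n + 1)), periodicEnergy v Φ ≤ periodicGroundStateEnergy v (n + 1) (sideLength ρ (n + 1)) +
      δ → ∃ π : Measure (Config (n + 1) × Config (n + 1)), π.map Prod.fst = volume.withDensity (fun
      Z => ofReal (groundState v (n + 1) (sideLength ρ (n + 1)) Z) ^ 2) ∧ π.map Prod.snd =
      ((volume.restrict (cellN (n + 1) (sideLength ρ (n + 1)))).withDensity fun W => (‖Φ.ψ W‖₊ :
      ℝ≥0∞) ^ 2) ∧ ∃ G : Set (Config (n + 1) × Config (n + 1)), MeasurableSet G ∧ ofReal (1 - η) ≤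
      π G ∧ ∀ p ∈ G, 0 < ∫⁻ x in {x : Space | ∀ t, x t ∈ Set.Ioo (1 / 4 * sideLength ρ (n + 1))
      (sideLength ρ (n + 1) - 1 / 4 * sideLength ρ (n + 1))}, ofReal (groundState v (n + 1)
      (sideLength ρ (n + 1)) (vecCons x (vecTail p.1))) ^ 2 ∧ ∫⁻ x in {x : Space | ∀ t, x t ∈
      Set.Ioo (1 / 4 * sideLength ρ (n + 1)) (sideLength ρ (n + 1) - 1 / 4 * sideLength ρ (n +
      1))}, ofReal (groundState v (n + 1) (sideLength ρ (n + 1)) (vecCons x (vecTail p.1))) ^ 2 < ⊤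
      ∧ ∫⁻ x, ofReal (groundState v (n + 1) (sideLength ρ (n + 1)) (vecCons x (vecTail p.1))) ^ 2 <
      ⊤ ∧ ∃ S ⊆ {x : Space | ∀ t, x t ∈ Set.Ioo (1 / 4 * sideLength ρ (n + 1)) (sideLength ρ (n +
      1) - 1 / 4 * sideLength ρ (n + 1))}, MeasurableSet S ∧ volume S ≤ ofReal ε * volume {x :
      Space | ∀ t, x t ∈ Set.Ioo (1 / 4 * sideLength ρ (n + 1)) (sideLength ρ (n + 1) - 1 / 4 *
      sideLength ρ (n + 1))} ∧ ∫⁻ x in S, ofReal (groundState v (n + 1) (sideLength ρ (n + 1))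
      (vecCons x (vecTail p.1))) ^ 2 ≤ ofReal ε * ∫⁻ x in {x : Space | ∀ t, x t ∈ Set.Ioo (1 / 4 *
      sideLength ρ (n + 1)) (sideLength ρ (n + 1) - 1 / 4 * sideLength ρ (n + 1))}, ofReal
      (groundState v (n + 1) (sideLength ρ (n + 1)) (vecCons x (vecTail p.1))) ^ 2 ∧ ∫⁻ y in S,
      ofReal ‖Φ.ψ (vecCons y (vecTail p.2))‖ ^ 2 ≤ ofReal ε * ∫⁻ y in {x : Space | ∀ t, x t ∈
      Set.Ioo (1 / 4 * sideLength ρ (n + 1)) (sideLength ρ (n + 1) - 1 / 4 * sideLength ρ (n +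
      1))}, ofReal ‖Φ.ψ (vecCons y (vecTail p.2))‖ ^ 2 ∧ (∀ x ∈ {x : Space | ∀ t, x t ∈ Set.Ioo (1
      / 4 * sideLength ρ (n + 1)) (sideLength ρ (n + 1) - 1 / 4 * sideLength ρ (n + 1))} \ S, ∀ y ∈
      {x : Space | ∀ t, x t ∈ Set.Ioo (1 / 4 * sideLength ρ (n + 1)) (sideLength ρ (n + 1) - 1 / 4
      * sideLength ρ (n + 1))} \ S, groundState v (n + 1) (sideLength ρ (n + 1)) (vecCons x
      (vecTail p.1)) * ‖Φ.ψ (vecCons y (vecTail p.2))‖ ≤ Real.exp M * (groundState v (n + 1)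
      (sideLength ρ (n + 1)) (vecCons y (vecTail p.1)) * ‖Φ.ψ (vecCons x (vecTail p.2))‖)) ∧ ∃ T :
      Set Space, MeasurableSet T ∧ ∫⁻ y in T, ofReal (groundState v (n + 1) (sideLength ρ (n + 1))
      (vecCons y (vecTail p.1))) ^ 2 ≤ ofReal ε * ∫⁻ x, ofReal (groundState v (n + 1) (sideLength ρ
      (n + 1)) (vecCons x (vecTail p.1))) ^ 2 ∧ ∀ x ∈ {x : Space | ∀ t, x t ∈ Set.Ioo (1 / 4 *
      sideLength ρ (n + 1)) (sideLength ρ (n + 1) - 1 / 4 * sideLength ρ (n + 1))} \ S, ∀ y ∈ (cell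
      (sideLength ρ (n + 1)) \ {x : Space | ∀ t, x t ∈ Set.Ioo (1 / 4 * sideLength ρ (n + 1))
      (sideLength ρ (n + 1) - 1 / 4 * sideLength ρ (n + 1))}) \ T, groundState v (n + 1)
      (sideLength ρ (n + 1)) (vecCons y (vecTail p.1)) * ‖Φ.ψ (vecCons x (vecTail p.2))‖ ≤ Real.exp
      M * (groundState v (n + 1) (sideLength ρ (n + 1)) (vecCons x (vecTail p.1)) * ‖Φ.ψ (vecCons y
      (vecTail p.2))‖)) → BECWallDressingTransfer.GroundStateRigidity →
      BECPeriodicReduction.BoundaryTransferWeak := by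
  intro hR hRig v hv hA
  obtain ⟨ρA, hρA, HA⟩ := hA
  obtain ⟨ρ₁, hρ₁, HR⟩ := hR v hv
  obtain ⟨ρe, hρe, HE⟩ :=
    Summit.AtomisticToContinuum.BoseEinsteinCondensation.Theorems.BECInsertionVariance.eventually_groundStateEnergy_ne_top
      hv
  obtain ⟨ρ₂, hρ₂, HC⟩ := stub_closing v hv hRig
  refine ⟨min (min ρA ρ₁) (min ρe ρ₂), lt_min (lt_min hρA hρ₁) (lt_min hρe hρ₂),
    fun ρ hρ hρlt => ?_⟩
  have hρA' : ρ < ρA := hρlt.trans_le ((min_le_left _ _).trans (min_le_left _ _))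
  have hρ₁' : ρ < ρ₁ := hρlt.trans_le ((min_le_left _ _).trans (min_le_right _ _))
  have hρe' : ρ < ρe := hρlt.trans_le ((min_le_right _ _).trans (min_le_left _ _))
  have hρ₂' : ρ < ρ₂ := hρlt.trans_le ((min_le_right _ _).trans (min_le_right _ _))
  obtain ⟨c, hc, hAev⟩ := HA ρ hρ hρA'
  -- tolerances, fixed before `N`
  set ε : ℝ := min (Real.sqrt c / 8) (1 / 2) with hεdef
  set η : ℝ := c / 32 with hηdef
  have hsc : 0 < Real.sqrt c := Real.sqrt_pos.2 hc
  have hε : 0 < ε := lt_min (by positivity) (by norm_num)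
  have hε1 : ε ≤ Real.sqrt c / 8 := min_le_left _ _
  have hε2 : ε ≤ 1 / 2 := min_le_right _ _
  have hη : 0 < η := by positivity
  have hη' : η < c / 16 := by rw [hηdef]; linarith
  obtain ⟨M, hRev⟩ := HR ρ hρ hρ₁' ε hε η hη
  have hκ := boxConstant_pos M hc hε1 hε2 hη'
  -- shift `A` and the finiteness of `E₀^D` to `N = n + 1`
  have hAev' := (tendsto_add_atTop_nat 1).eventually hAev
  have hEev' := (tendsto_add_atTop_nat 1).eventually (HE ρ hρ hρe')
  refine HC ρ hρ hρ₂' _ hκ ?_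
  filter_upwards [hAev', hEev', hRev] with n hAn hEn hRn
  refine ⟨hEn, ?_⟩
  obtain ⟨δA, hδA, hAΦ⟩ := hAn
  obtain ⟨δR, hδR, hRΦ⟩ := hRn hEn
  have hL : 0 < sideLength ρ (n + 1) := by
    unfold sideLength
    exact Real.rpow_pos_of_pos (div_pos (Nat.cast_pos.mpr (Nat.succ_pos n)) hρ) _
  -- T′ at slack `min δA δR`: the torus near-minimiser and its typical bath event
  obtain ⟨Φ, hΦE, E, hEm, hPE, hEgood⟩ := stub_torusTypicalityBath v n (sideLength ρ (n + 1)) hL c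
    hc (min δA δR) (lt_min hδA hδR)
    fun Φ hΦ => hAΦ Φ (hΦ.trans (add_le_add_right (min_le_left _ _) _))
  -- R′: the coupling with its good event
  obtain ⟨π, hπ1, hπ2, G, hG, hπG, hGood⟩ :=
    hRΦ Φ (hΦE.trans (add_le_add_right (min_le_right _ _) _))
  -- B′: the inner flat mode of the box is occupied in the Dirichlet ground state
  exact stub_boxTransferBath stub_multiplicativeTransfer v n (sideLength ρ (n + 1)) hL hEn c ε η M
    hc hε hε1 hε2 hη hη' Φ ⟨π, hπ1, hπ2, G, hG, hπG, hGood⟩ ⟨E, hEm, hPE, hEgood⟩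

/-- The lead's route copy: `BECInsertionCorrector.BoundaryTransferWeak` is the same `Prop` (`rfl`),
so the reduction serves it verbatim. [folklore] -/
example : BECInsertionCorrector.BoundaryTransferWeak = BECPeriodicReduction.BoundaryTransferWeak :=
  rfl

end Summit.AtomisticToContinuum.BoseEinsteinCondensation.CoupledBaths

end
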